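import Mathlib
import HarnessLib
import Literature.Analysis.FluidPDE.SuitableWeak
import Literature.Analysis.FluidPDE.LocalTypeI
import Literature.Analysis.FluidPDE.SpaceTimeRescaling
import Summits.NavierStokesRegularity.NavierStokesRegularity.Theorems.LocalSineTubeDoorLocalPointZoomRate

/-!
# STAGED door S15 `LocalIrrotationalScarDoor` (nsreg-p1 ROUND-14), zoom crux `K1Rep` (`LocalPointZoomScarCurlRep`) —
# support tools, part 2: the SPACE–TIME (apex) local Type-I bound passes to the zoom-in limit

Step (ii) of the `K1Rep` plan (ROUND-14 §4 Day 2).  The door's hypothesis is the LOCAL SPACE–TIME Type-I bound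
`‖u(t,x)‖ · (‖x − x₀‖ + √(ν(T−t))) ≤ M` on the parabolic cylinder `]T−ρ², T[ × B(x₀, ρ)`; the zooms of the tree
frame `…LocalSineTubeDoorLocalPointZoomFrame.localTreeZoomFrame` are identified with
`Zⱼ(s, y) = (μⱼ/ν) u(T + μⱼ² s/ν, x₀ + μⱼ y)`, `μⱼ = Rλⱼ/2 → 0⁺`, and converge to `w` in `L³(Q(0,a))` for every `a`.

* `ae_le_of_L3_limit` — generic: if `Fⱼ → W` in `L³(Q(0,a))` for every `a > 0` and, for every `a`, eventually
  `‖Fⱼ z‖ ≤ B z` on `Q(0,a)`, then `‖W z‖ ≤ B z` for a.e. `z` in the backward slab (subsequence a.e. convergence);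
* `norm_zoom_le_apex` — the pointwise apex bound `‖Zⱼ(s,y)‖ ≤ (M/ν)/(‖y‖ + √(−s))` wherever the zoomed point lies
  in the hypothesis region;
* `eventually_zoom_region` — on `Q(0,a)` the zoomed points eventually lie in the hypothesis region;
* `ae_apex_of_zoomLimit` — **the apex bound `‖w(s,y)‖ ≤ (M/ν)/(‖y‖ + √(−s))` a.e. on `ℝ₋ × ℝ³`** for the limit.

Pattern: the tree's `…LocalSineTubeDoorLocalPointZoomRate.ae_rate_of_zoomLimit_of_ball` (rate `C/√(−s)`), with the
space–time weight.  Seat nsreg-p6 g7; helper toward the S15 zoom crux (anchor `--supports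
stmt-NavierStokesRegularity-11719`).  WHAT THIS IS NOT: not NS regularity; not `K1Rep` (its top-curl fading clause
is the open part).
-/

noncomputable section

open MeasureTheory Set Function Filter Topology TopologicalSpace Metric
open Literature.Analysis Literature.Analysis.FluidPDE
open scoped NNReal ENNReal

-- the summit and its single sub-problem share the name (CONVENTIONS §1), as in every Theorems file
set_option linter.dupNamespace false

namespace Summit.NavierStokesRegularity.NavierStokesRegularity.Theorems.LocalIrrotationalScarDoorZoomApex

/-- **Pointwise bounds pass to `L³_loc` limits on the backward slab.**  If `Fⱼ → W` in `L³(Q(0,a))` for every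
`a > 0` (with the measurability that makes the `L³` norms meaningful) and for every `a` eventually
`‖Fⱼ z‖ ≤ B z` for all `z ∈ Q(0,a)`, then `‖W z‖ ≤ B z` for a.e. `z ∈ ℝ₋ × ℝ³`. -/
theorem ae_le_of_L3_limit {F : ℕ → ℝ × EuclideanSpace ℝ (Fin 3) → EuclideanSpace ℝ (Fin 3)}
    {W : ℝ × EuclideanSpace ℝ (Fin 3) → EuclideanSpace ℝ (Fin 3)} {B : ℝ × EuclideanSpace ℝ (Fin 3) → ℝ}
    (hFm : ∀ a : ℝ, 0 < a → ∀ᶠ j in atTop,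
      AEStronglyMeasurable (F j) (volume.restrict (parabolicCylinder a (0 : ℝ × EuclideanSpace ℝ (Fin 3)))))
    (hWm : ∀ a : ℝ, 0 < a →
      AEStronglyMeasurable W (volume.restrict (parabolicCylinder a (0 : ℝ × EuclideanSpace ℝ (Fin 3)))))
    (hconv : ∀ a : ℝ, 0 < a → Tendsto (fun j => eLpNorm (F j - W) 3
      (volume.restrict (parabolicCylinder a (0 : ℝ × EuclideanSpace ℝ (Fin 3))))) atTop (𝓝 0))
    (hbd : ∀ a : ℝ, 0 < a → ∀ᶠ j in atTop,
      ∀ z ∈ parabolicCylinder a (0 : ℝ × EuclideanSpace ℝ (Fin 3)), ‖F j z‖ ≤ B z) :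
    ∀ᵐ z ∂(volume.restrict (Iio (0 : ℝ) ×ˢ (univ : Set (EuclideanSpace ℝ (Fin 3))))), ‖W z‖ ≤ B z := by
  -- reduce to the exhausting cylinders `Q(0, n + 1)`
  have hcover : Iio (0 : ℝ) ×ˢ (univ : Set (EuclideanSpace ℝ (Fin 3))) ⊆
      ⋃ n : ℕ, parabolicCylinder ((n : ℝ) + 1) (0 : ℝ × EuclideanSpace ℝ (Fin 3)) := by
    rintro ⟨s, y⟩ ⟨hs, -⟩
    obtain ⟨n, hn⟩ := exists_nat_ge (max (-s) ‖y‖)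
    have h1 : -s ≤ n := (le_max_left _ _).trans hn
    have h2 : ‖y‖ ≤ n := (le_max_right _ _).trans hn
    have hs' : s < 0 := hs
    refine mem_iUnion.2 ⟨n, ?_⟩
    rw [SuitableCompactness.mem_parabolicCylinder_zero]
    refine ⟨⟨?_, hs'⟩, by simp only; linarith⟩
    have h3 : (n : ℝ) + 1 ≤ ((n : ℝ) + 1) ^ 2 := by nlinarith [n.cast_nonneg (α := ℝ)]
    simp only
    linarith
  refine ae_restrict_of_ae_restrict_of_subset hcover ?_
  rw [ae_restrict_iUnion_iff]
  intro n
  set a : ℝ := (n : ℝ) + 1 with ha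
  have ha0 : 0 < a := by positivity
  set Q₀ : Set (ℝ × EuclideanSpace ℝ (Fin 3)) :=
    parabolicCylinder a (0 : ℝ × EuclideanSpace ℝ (Fin 3)) with hQ₀
  obtain ⟨J, hJ⟩ := eventually_atTop.1 ((hFm a ha0).and (hbd a ha0))
  have hconv' : Tendsto (fun j => eLpNorm (F (j + J) - W) 3 (volume.restrict Q₀)) atTop (𝓝 0) :=
    (hconv a ha0).comp (tendsto_add_atTop_nat J)
  have hmeasJ : ∀ j, AEStronglyMeasurable (F (j + J)) (volume.restrict Q₀) := fun j =>
    (hJ (j + J) (Nat.le_add_left J j)).1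
  have hTIM : TendstoInMeasure (volume.restrict Q₀) (fun j => F (j + J)) atTop W :=
    tendstoInMeasure_of_tendsto_eLpNorm (by norm_num) hmeasJ (hWm a ha0) hconv'
  obtain ⟨ns, -, hae⟩ := hTIM.exists_seq_tendsto_ae
  have hptw : ∀ j, ∀ z ∈ Q₀, ‖F (j + J) z‖ ≤ B z := fun j z hz =>
    (hJ (j + J) (Nat.le_add_left J j)).2 z hz
  filter_upwards [hae, ae_restrict_mem (isOpen_parabolicCylinder a _).measurableSet] with z hz hzQ
  exact le_of_tendsto hz.norm (Eventually.of_forall fun k => hptw (ns k) z hzQ)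

variable {u : ℝ → EuclideanSpace ℝ (Fin 3) → EuclideanSpace ℝ (Fin 3)} {ν T : ℝ} {x₀ : EuclideanSpace ℝ (Fin 3)}
  {ρ M : ℝ}

/-- **The apex bound of one zoom, pointwise.**  Under the local space–time Type-I bound
`‖u(t,x)‖ · (‖x − x₀‖ + √(ν(T−t))) ≤ M` on `]T−ρ², T[ × B(x₀,ρ)` (times in `[0,T)`), the zoom
`Z(s,y) = (μ/ν) u(T + μ² s/ν, x₀ + μ y)`, `μ > 0`, satisfies `‖Z(s,y)‖ ≤ (M/ν)/(‖y‖ + √(−s))` at every `(s,y)`,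
`s < 0`, whose zoomed point lies in that region. -/
theorem norm_zoom_le_apex (hν : 0 < ν)
    (hM : ∀ t ∈ Ico 0 T, T - ρ ^ 2 < t → ∀ x ∈ ball x₀ ρ,
      ‖u t x‖ * (‖x - x₀‖ + Real.sqrt (ν * (T - t))) ≤ M)
    {μ : ℝ} (hμ : 0 < μ) {s : ℝ} (hs : s < 0) {y : EuclideanSpace ℝ (Fin 3)}
    (ht : T + μ ^ 2 * s / ν ∈ Ico 0 T) (hρt : T - ρ ^ 2 < T + μ ^ 2 * s / ν) (hy : x₀ + μ • y ∈ ball x₀ ρ) :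
    ‖(μ / ν) • u (T + μ ^ 2 * s / ν) (x₀ + μ • y)‖ ≤ (M / ν) / (‖y‖ + Real.sqrt (-s)) := by
  have h := hM _ ht hρt _ hy
  have e1 : ‖x₀ + μ • y - x₀‖ = μ * ‖y‖ := by
    rw [add_sub_cancel_left, norm_smul, Real.norm_of_nonneg hμ.le]
  have e2 : Real.sqrt (ν * (T - (T + μ ^ 2 * s / ν))) = μ * Real.sqrt (-s) := by
    have : ν * (T - (T + μ ^ 2 * s / ν)) = μ ^ 2 * (-s) := by field_simp; ring
    rw [this, Real.sqrt_mul (sq_nonneg _), Real.sqrt_sq hμ.le]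
  rw [e1, e2, ← mul_add] at h
  have hden : 0 < ‖y‖ + Real.sqrt (-s) :=
    add_pos_of_nonneg_of_pos (norm_nonneg _) (Real.sqrt_pos.2 (by linarith))
  -- `‖u‖ ≤ M / (μ (‖y‖ + √(-s)))`
  have hu : ‖u (T + μ ^ 2 * s / ν) (x₀ + μ • y)‖ ≤ M / (μ * (‖y‖ + Real.sqrt (-s))) := by
    rw [le_div_iff₀ (mul_pos hμ hden)]
    exact h
  rw [norm_smul, Real.norm_of_nonneg (div_nonneg hμ.le hν.le)]
  calc μ / ν * ‖u (T + μ ^ 2 * s / ν) (x₀ + μ • y)‖ ≤ μ / ν * (M / (μ * (‖y‖ + Real.sqrt (-s)))) :=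
        mul_le_mul_of_nonneg_left hu (div_nonneg hμ.le hν.le)
    _ = (M / ν) / (‖y‖ + Real.sqrt (-s)) := by
        field_simp

/-- **The zoomed points of `Q(0,a)` eventually lie in the hypothesis region.**  For scales `μⱼ → 0⁺` and
`(s,y) ∈ Q(0,a)`: eventually `T + μⱼ² s/ν ∈ [0,T)`, `T − ρ² < T + μⱼ² s/ν` and `x₀ + μⱼ y ∈ B(x₀, ρ)`. -/
theorem eventually_zoom_region (hν : 0 < ν) (hT : 0 < T) (hρ : 0 < ρ) {μ : ℕ → ℝ} (hμ : ∀ j, 0 < μ j)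
    (hμ0 : Tendsto μ atTop (𝓝 0)) {a : ℝ} (ha : 0 < a) :
    ∀ᶠ j in atTop, ∀ z ∈ parabolicCylinder a (0 : ℝ × EuclideanSpace ℝ (Fin 3)),
      T + μ j ^ 2 * z.1 / ν ∈ Ico 0 T ∧ T - ρ ^ 2 < T + μ j ^ 2 * z.1 / ν ∧ x₀ + μ j • z.2 ∈ ball x₀ ρ := by
  -- `μⱼ a < min ρ (√(ν T))` and `μⱼ a < ρ √ν / ...`: we ask `μⱼ < m` with `m a ≤ ρ`, `(m a)² ≤ ν T`, `(m a)² ≤ ν ρ²`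
  have hm : (0 : ℝ) < min (ρ / a) (min (Real.sqrt (ν * T) / a) (Real.sqrt ν * ρ / a)) := by positivity
  filter_upwards [hμ0 (Iio_mem_nhds hm)] with j hj
  have hj' : μ j < min (ρ / a) (min (Real.sqrt (ν * T) / a) (Real.sqrt ν * ρ / a)) := hj
  have hμj := hμ j
  have h1 : μ j * a < ρ := by
    have := (lt_min_iff.1 hj').1; rwa [lt_div_iff₀ ha] at this
  have h2 : μ j * a < Real.sqrt (ν * T) := by
    have := (lt_min_iff.1 (lt_min_iff.1 hj').2).1; rwa [lt_div_iff₀ ha] at this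
  have h3 : μ j * a < Real.sqrt ν * ρ := by
    have := (lt_min_iff.1 (lt_min_iff.1 hj').2).2; rwa [lt_div_iff₀ ha] at this
  rintro ⟨s, y⟩ hz
  rw [SuitableCompactness.mem_parabolicCylinder_zero] at hz
  obtain ⟨⟨hs1, hs2⟩, hy⟩ := hz
  simp only at hs1 hs2 hy ⊢
  have hμa2 : (μ j) ^ 2 * (-s) < (μ j * a) ^ 2 := by
    rw [mul_pow]; exact mul_lt_mul_of_pos_left (by nlinarith) (pow_pos hμj 2)
  have hneg : μ j ^ 2 * s / ν < 0 := div_neg_of_neg_of_pos (by nlinarith [pow_pos hμj 2]) hν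
  refine ⟨⟨?_, by linarith⟩, ?_, ?_⟩
  · -- `μ² (-s) ≤ (μ a)² < ν T`
    have h4 : (μ j * a) ^ 2 < ν * T := by
      have := pow_lt_pow_left₀ h2 (by positivity) two_ne_zero
      rwa [Real.sq_sqrt (by positivity)] at this
    have h5 : μ j ^ 2 * (-s) < ν * T := hμa2.trans h4
    have e : T + μ j ^ 2 * s / ν = (ν * T - μ j ^ 2 * (-s)) / ν := by field_simp; ring
    rw [e]
    exact div_nonneg (by linarith) hν.le
  · -- `μ² (-s) < ν ρ²`
    have h4 : (μ j * a) ^ 2 < ν * ρ ^ 2 := by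
      have := pow_lt_pow_left₀ h3 (by positivity) two_ne_zero
      rw [mul_pow (Real.sqrt ν), Real.sq_sqrt hν.le] at this
      linarith [this]
    have h5 : μ j ^ 2 * (-s) < ν * ρ ^ 2 := hμa2.trans h4
    have e : T + μ j ^ 2 * s / ν = T - μ j ^ 2 * (-s) / ν := by ring
    rw [e, sub_lt_sub_iff_left, div_lt_iff₀ hν]
    linarith
  · rw [mem_ball, dist_eq_norm, add_sub_cancel_left, norm_smul, Real.norm_of_nonneg hμj.le]
    calc μ j * ‖y‖ ≤ μ j * a := mul_le_mul_of_nonneg_left hy.le hμj.le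
      _ < ρ := h1

/-- **The apex bound passes to the zoom-in limit, almost everywhere on the slab.**  In the setting of the tree
frame (zooms identified with `Zⱼ(s,y) = (μⱼ/ν) u(T + μⱼ² s/ν, x₀ + μⱼ y)`, `μⱼ → 0⁺`, converging to `w` in
`L³(Q(0,a))` for every `a`), the local space–time Type-I bound at `(x₀, T)` gives
`‖w(s,y)‖ ≤ (M/ν)/(‖y‖ + √(−s))` for a.e. `(s,y) ∈ ℝ₋ × ℝ³`. -/
theorem ae_apex_of_zoomLimit (hν : 0 < ν) (hT : 0 < T) (hρ : 0 < ρ)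
    (hM : ∀ t ∈ Ico 0 T, T - ρ ^ 2 < t → ∀ x ∈ ball x₀ ρ,
      ‖u t x‖ * (‖x - x₀‖ + Real.sqrt (ν * (T - t))) ≤ M)
    {Z : ℕ → ℝ → EuclideanSpace ℝ (Fin 3) → EuclideanSpace ℝ (Fin 3)} {μ : ℕ → ℝ} (hμ : ∀ j, 0 < μ j)
    (hμ0 : Tendsto μ atTop (𝓝 0))
    (hZ : ∀ (j : ℕ) (s : ℝ) (y : EuclideanSpace ℝ (Fin 3)), Z j s y = (μ j / ν) • u (T + μ j ^ 2 * s / ν) (x₀ + μ j • y))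
    {w : ℝ → EuclideanSpace ℝ (Fin 3) → EuclideanSpace ℝ (Fin 3)}
    (hZm : ∀ a : ℝ, 0 < a → ∀ᶠ j in atTop,
      AEStronglyMeasurable (uncurry (Z j)) (volume.restrict (parabolicCylinder a (0 : ℝ × EuclideanSpace ℝ (Fin 3)))))
    (hwm : ∀ a : ℝ, 0 < a →
      AEStronglyMeasurable (uncurry w) (volume.restrict (parabolicCylinder a (0 : ℝ × EuclideanSpace ℝ (Fin 3)))))
    (hconv : ∀ a : ℝ, 0 < a → Tendsto (fun j => eLpNorm (uncurry (Z j) - uncurry w) 3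
      (volume.restrict (parabolicCylinder a (0 : ℝ × EuclideanSpace ℝ (Fin 3))))) atTop (𝓝 0)) :
    ∀ᵐ z ∂(volume.restrict (Iio (0 : ℝ) ×ˢ (univ : Set (EuclideanSpace ℝ (Fin 3))))),
      ‖w z.1 z.2‖ ≤ (M / ν) / (‖z.2‖ + Real.sqrt (-z.1)) := by
  have h := ae_le_of_L3_limit (F := fun j => uncurry (Z j)) (W := uncurry w)
    (B := fun z => (M / ν) / (‖z.2‖ + Real.sqrt (-z.1))) hZm hwm hconv ?_
  · filter_upwards [h] with z hz
    obtain ⟨s, y⟩ := z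
    exact hz
  intro a ha
  filter_upwards [eventually_zoom_region (x₀ := x₀) hν hT hρ hμ hμ0 ha] with j hj
  rintro ⟨s, y⟩ hz
  obtain ⟨ht, hρt, hy⟩ := hj ⟨s, y⟩ hz
  have hs : s < 0 := by
    rw [SuitableCompactness.mem_parabolicCylinder_zero] at hz; exact hz.1.2
  simp only [uncurry_apply_pair, hZ]
  exact norm_zoom_le_apex hν hM (hμ j) hs ht hρt hy

end Summit.NavierStokesRegularity.NavierStokesRegularity.Theorems.LocalIrrotationalScarDoorZoomApex

end
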